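import Summits.ResolutionOfSingularities.ResolutionOfSingularities.Theorems.HilbertSamuelEliminationSigmaMaxModificationsCorridor3QuadraticTransformFibre
import Literature.AlgebraicGeometry.Resolution.MaximalPoints
import Literature.AlgebraicGeometry.Resolution.ResolutionOfCurves
import Literature.Topology.KrullDimensionDrop
import HarnessLib

/-!
# Route `HilbertSamuelElimination`, crux `SigmaMaxModificationsCorridor3`
# (stmt-ResolutionOfSingularities-19249; child of `SigmaMaxModifications` stmt-…-18506),
# line `tame_wild` v3 — CODIMENSION-ONE POINTS OF A HILBERT–SAMUEL STRATUM

[OURS · L1 W4.2] Brick W3 of the FC-R1 assembly plan (HOME `L/res-L1-w42-stub-3/FCR1-PLAN.md`):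
the point-set bookkeeping that feeds each confinement round (`exists_centreSeq_round`, p482115)
with its input surface `S = closure of the codimension-one points of Y(ν) over T`, reduced:

* `eq_of_specializes_of_primeOfSpecializes_eq_maximalIdeal` — a generisation `y ⤳ x` with
  `𝔭_y = 𝔪_x` is `x` itself (Stacks 01J7).
* `maximalIdeal_mem_minimalPrimes_of_specializes_of_ne` — over a point `x` with `dim 𝒪_{X,x} ≤ 1`,
  a proper generisation `y ⤳ x`, `y ≠ x`, is a maximal point of `X` (`𝔭_y` has height `0`).
* `mem_maxPoints_hsStratum_of_ringKrullDim_le_one` — hence **a point of `Y(ν)`, `ν ≠ Φ^{(N)}`,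
  with `dim 𝒪_{Y,y} ≤ 1` is a MAXIMAL point of the stratum** (`maxPoints`, tree
  `MaximalPoints.lean`): its proper generisations are generic points of the reduced `Y`, of value
  `Φ^{(N)}` (p478970 `hsFun_eq_iterPSum_Phi_of_maximalIdeal_mem_minimalPrimes`).
* `topologicalKrullDim_lt_of_subset_hsStratum` — **a closed subset of a stratum `ν ≠ Φ^{(N)}` of
  a reduced `Y` with `dim Y < k + 1` has dimension `< k`** (dimension drop, tree
  `topologicalKrullDim_lt_of_forall_exists_specializes`: every point is a specialisation of a
  generic point of `Y`, which is not in the stratum); `topologicalKrullDim_subscheme_vanishingIdeal_lt`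
  — the same for the reduced closed subscheme `S = V(𝓘_Z)` carried by it.
* `maximalIdeal_mem_minimalPrimes_subscheme_of_mem_maxPoints` — a point of the reduced closed
  subscheme on `Z ⊆ Y(ν)` lying over a maximal point of the stratum is a maximal point of `S`
  (the hypothesis shape of `exists_centreSeq_round`).

NOT a statement of any manuscript; AI-written, weaker than expert review.

## Sources

* V. Cossart, U. Jannsen, S. Saito, LNM 2270 (2020), Lemma 2.31, Def. 2.28, Rem. 6.29 (1).
  [CossartJannsenSaito2020]
* The Stacks Project, Tags 01J7, 0BA8. [StacksProject]
-/

set_option linter.dupNamespace false -- mandated namespace of this single-conjunct summit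

noncomputable section

open CategoryTheory AlgebraicGeometry TopologicalSpace Topology IsLocalRing
open Literature.AlgebraicGeometry.Resolution Literature.RingTheory.HilbertSamuel Literature.Topology

namespace Summit.ResolutionOfSingularities.ResolutionOfSingularities.Theorems.SigmaMaxModificationsCorridor3.Helpers

universe u

/-! ## Generisations of a point of codimension `≤ 1` -/

/-- A generisation `y ⤳ x` whose prime `𝔭_y ⊆ 𝒪_{X,x}` is the maximal ideal is `x` itself
(`y` is the image of the closed point of `Spec 𝒪_{X,x}`). [cite: StacksProject, Tag 01J7] -/
theorem eq_of_specializes_of_primeOfSpecializes_eq_maximalIdeal {X : Scheme.{u}} {x y : X}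
    (h : y ⤳ x) (hp : primeOfSpecializes h = maximalIdeal (X.presheaf.stalk x)) : y = x := by
  have h1 := Literature.AlgebraicGeometry.Motives.fromSpecStalk_comap_maximalIdeal h
  have h2 : (⟨(maximalIdeal (X.presheaf.stalk y)).comap (X.presheaf.stalkSpecializes h).hom,
      inferInstance⟩ : Spec (X.presheaf.stalk x)) = closedPoint (X.presheaf.stalk x) := by
    apply PrimeSpectrum.ext
    exact hp
  rw [h2, Scheme.fromSpecStalk_closedPoint] at h1
  exact h1.symm

/-- Over a point `x` with `dim 𝒪_{X,x} ≤ 1`, a generisation `y ⤳ x` different from `x` is a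
maximal point of `X`: `𝔭_y ⊊ 𝔪_x` has height `0`, i.e. is a minimal prime, so `𝔪_y` is a
minimal prime of `𝒪_{X,y} = (𝒪_{X,x})_{𝔭_y}`. [cite: StacksProject, Tag 01J7] -/
theorem maximalIdeal_mem_minimalPrimes_of_specializes_of_ne {X : Scheme.{u}}
    [IsLocallyNoetherian X] {x y : X} (h : y ⤳ x) (hne : y ≠ x)
    (hdim : ringKrullDim (X.presheaf.stalk x) ≤ 1) :
    maximalIdeal (X.presheaf.stalk y) ∈ minimalPrimes (X.presheaf.stalk y) := by
  rw [← primeOfSpecializes_mem_minimalPrimes_iff h]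
  haveI : (primeOfSpecializes h).IsPrime := Ideal.IsPrime.comap _
  have hlt : primeOfSpecializes h < maximalIdeal (X.presheaf.stalk x) :=
    lt_of_le_of_ne (le_maximalIdeal (Ideal.IsPrime.ne_top inferInstance))
      (fun heq => hne (eq_of_specializes_of_primeOfSpecializes_eq_maximalIdeal h heq))
  have h1 := Ideal.height_strict_mono_of_isPrime_of_isPrime hlt
  have h2 : ((primeOfSpecializes h).height : WithBot ℕ∞) < 1 :=
    calc ((primeOfSpecializes h).height : WithBot ℕ∞)
        < ((maximalIdeal (X.presheaf.stalk x)).height : WithBot ℕ∞) := by exact_mod_cast h1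
      _ = ringKrullDim (X.presheaf.stalk x) := IsLocalRing.maximalIdeal_height_eq_ringKrullDim
      _ ≤ 1 := hdim
  rw [← Ideal.height_eq_zero_iff]
  have h3 : (primeOfSpecializes h).height < 1 := by exact_mod_cast h2
  exact Order.lt_one_iff.mp h3

/-- **A point of codimension `≤ 1` in a stratum `Y(ν)`, `ν ≠ Φ^{(N)}`, of a reduced scheme is a
maximal point of the stratum**: a proper generisation of it is a maximal point of `Y`, hence of
value `Φ^{(N)}` (reduced local ring of dimension `0` is a field), so not in `Y(ν)`.
[cite: CossartJannsenSaito2020, Lemma 2.31] -/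
theorem mem_maxPoints_hsStratum_of_ringKrullDim_le_one {Y : Scheme.{u}} [IsLocallyNoetherian Y]
    [IsReduced Y] {N : ℕ} {ν : ℕ → ℕ} (hν : ν ≠ iterPSum N Phi) {y : Y}
    (hy : y ∈ Scheme.hsStratum Y N ν) (hdim : ringKrullDim (Y.presheaf.stalk y) ≤ 1) :
    y ∈ maxPoints (Scheme.hsStratum Y N ν) := by
  refine ⟨hy, fun y' hy' h => ?_⟩
  by_contra hne
  exact maximalIdeal_not_mem_minimalPrimes_of_mem_hsStratum hν hy'
    (maximalIdeal_mem_minimalPrimes_of_specializes_of_ne h hne hdim)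

/-! ## Dimension of closed subsets of a stratum -/

/-- **Dimension drop inside a stratum**: a closed subset `Z` of `Y(ν)`, `ν ≠ Φ^{(N)}`, of a reduced
locally Noetherian `Y` with `dim Y < k + 1` has `dim Z < k` — every point of `Z` is a
specialisation of a generic point of `Y`, which has value `Φ^{(N)}` and so lies outside
`Y(ν) ⊇ Z`. [cite: CossartJannsenSaito2020, Lemma 2.31] -/
theorem topologicalKrullDim_lt_of_subset_hsStratum {Y : Scheme.{u}} [IsLocallyNoetherian Y]
    [IsReduced Y] {N : ℕ} {ν : ℕ → ℕ} (hν : ν ≠ iterPSum N Phi) {Z : Set Y} (hZ : IsClosed Z)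
    (hZν : Z ⊆ Scheme.hsStratum Y N ν) (k : ℕ)
    (hdim : topologicalKrullDim Y < (k + 1 : ℕ)) : topologicalKrullDim Z < (k : ℕ) := by
  refine topologicalKrullDim_lt_of_forall_exists_specializes isClosed_univ hZ (Set.subset_univ Z)
    (fun z hz => ?_) k ?_
  · obtain ⟨η, hη, hηmin⟩ := exists_specializes_maximalIdeal_mem_minimalPrimes z
    exact ⟨η, Set.mem_univ η,
      fun hηZ => maximalIdeal_not_mem_minimalPrimes_of_mem_hsStratum hν (hZν hηZ) hηmin, hη⟩
  · rwa [IsHomeomorph.topologicalKrullDim_eq _ (Homeomorph.Set.univ Y).isHomeomorph]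

/-- The same for the **reduced closed subscheme** `V(𝓘_Z)` carried by `Z` (homeomorphic to `Z`).
[cite: CossartJannsenSaito2020, Lemma 2.31] -/
theorem topologicalKrullDim_subscheme_vanishingIdeal_lt {Y : Scheme.{u}} [IsLocallyNoetherian Y]
    [IsReduced Y] {N : ℕ} {ν : ℕ → ℕ} (hν : ν ≠ iterPSum N Phi) (Z : Closeds Y)
    (hZν : (Z : Set Y) ⊆ Scheme.hsStratum Y N ν) (k : ℕ)
    (hdim : topologicalKrullDim Y < (k + 1 : ℕ)) :
    topologicalKrullDim (Scheme.IdealSheafData.vanishingIdeal Z).subscheme < (k : ℕ) := by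
  have h1 := topologicalKrullDim_lt_of_subset_hsStratum hν Z.2 hZν k hdim
  -- `V(𝓘_Z) → Y` is a closed embedding with range `Z`, hence a homeomorphism onto `Z`
  set ι := (Scheme.IdealSheafData.vanishingIdeal Z).subschemeι with hι
  have hrange : Set.range ι.base = (Z : Set Y) := range_subschemeι_vanishingIdeal Z
  have hemb : IsEmbedding ι.base := ι.isClosedEmbedding.isEmbedding
  have e : ↥((Scheme.IdealSheafData.vanishingIdeal Z).subscheme) ≃ₜ (Z : Set Y) :=
    hemb.toHomeomorph.trans (Homeomorph.setCongr hrange)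
  rwa [IsHomeomorph.topologicalKrullDim_eq _ e.isHomeomorph]

/-! ## Maximal points of the reduced subscheme on a subset of the stratum -/

/-- **A point of the reduced closed subscheme `S = V(𝓘_Z)`, `Z ⊆ Y(ν)`, lying over a maximal point
of the stratum is a maximal point of `S`** (`𝔪` is a minimal prime of its local ring): a maximal
point of `S` generising it maps to a point of `Z ⊆ Y(ν)` generising its image, hence to the image
itself, and `S → Y` is injective. [folklore] -/
theorem maximalIdeal_mem_minimalPrimes_subscheme_of_mem_maxPoints {Y : Scheme.{u}}
    {N : ℕ} {ν : ℕ → ℕ} (Z : Closeds Y) (hZν : (Z : Set Y) ⊆ Scheme.hsStratum Y N ν)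
    (s : ↥((Scheme.IdealSheafData.vanishingIdeal Z).subscheme))
    (hs : (Scheme.IdealSheafData.vanishingIdeal Z).subschemeι.base s ∈
      maxPoints (Scheme.hsStratum Y N ν)) :
    maximalIdeal (((Scheme.IdealSheafData.vanishingIdeal Z).subscheme).presheaf.stalk s) ∈
      minimalPrimes (((Scheme.IdealSheafData.vanishingIdeal Z).subscheme).presheaf.stalk s) := by
  set ι := (Scheme.IdealSheafData.vanishingIdeal Z).subschemeι with hι
  obtain ⟨η, hηs, hηmin⟩ := exists_specializes_maximalIdeal_mem_minimalPrimes s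
  have hιη : ι.base η ∈ Scheme.hsStratum Y N ν :=
    hZν (by rw [← range_subschemeι_vanishingIdeal Z]; exact ⟨η, rfl⟩)
  have heq : ι.base η = ι.base s := hs.2 _ hιη (hηs.map ι.continuous)
  have hηs' : η = s := ι.isClosedEmbedding.injective heq
  rw [← hηs']
  exact hηmin

end Summit.ResolutionOfSingularities.ResolutionOfSingularities.Theorems.SigmaMaxModificationsCorridor3.Helpers

end
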